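import Literature.NumberTheory.Sieve.SmoothProfileSums
import Literature.NumberTheory.Sieve.SmoothEndgameCircle
import HarnessLib

/-!
# `W`-class profile weights: the positive model weights and model sums

Topic `Literature/NumberTheory/Sieve`, namespace `Literature.NumberTheory.Sieve.SmoothArcs`; a PROVED tool file in the
smoothed circle method of [Harper2016, §5], sequel of `SmoothProfileSums` (profiles `p_c = Σ_ℓ c_ℓ W_ℓ`,
`P̂_c(α; λ) = Σ_ℓ c_ℓ Ŵ_{λ+ℓ}(α)`) and of the single-bump model of `SmoothEndgameCircle` (`modelWeight`,
`modelSum`, `norm_modelSum_sub_main_le`, `norm_modelSum_mul_distInt_le`).  On a major arc the profile sum over the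
friable integers at scale `X` has main term `𝓜 e^{−α} P̂_c(α; βX)`; the *model weights*

`μ(n) = (Mv/X) (n/X)^{α−1} p_c(n/X)`  (`1 ≤ n ≤ X`; `Mv` stands for `𝓜 e^{−α} ≥ 0`)

are nonnegative when `p_c ≥ 0`, and their exponential sum `M(β) = Σ_n μ(n) e(nβ)` (`profileModelSum`) reproduces
that main term, so that main terms of additive problems are counted by the circle identity with manifestly positive
model counts.  Since `(n/X)^{α−1} W_ℓ(n/X) = b_α(n/X) e(ℓ n/X)` (`b_α(v) = v^{α+1}(1−v)²`, `bump`), the model sum is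
the series `Σ_ℓ c_ℓ · modelSum Mv X α (β + ℓ/X)` of single-bump model sums (`profileModelSum_eq_tsum`), and the
single-bump statements of `SmoothEndgameCircle` transfer term by term (`S₁ = Σ_ℓ ‖c_ℓ‖(1+|ℓ|)`).  This file:

* definitions `profileModelWeight`, `profileModelSum`; support (`profileModelWeight_of_not_mem`, `_zero`,
  `_eq_zero_of_lt`, `profileModelSum_eq_sum_Icc`), the expansion `profileModelWeight_mul_fourierChar`,
  `profileModelSum_eq_tsum`, and the sup bounds `norm_modelSum_le`, `norm_profileModelSum_le`
  (`‖M(β)‖ ≤ Mv Σ_ℓ‖c_ℓ‖`), `norm_profileModelWeight_le` (`‖μ(n)‖ ≤ (Mv/X) Σ_ℓ‖c_ℓ‖`);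
* (M1) `norm_profileModelSum_sub_le`: `‖M(β) − Mv P̂_c(α; βX)‖ ≤ 12 Mv (1+|βX|) S₁ / X` (`X ≥ 1`, `0 ≤ α ≤ 1`);
* (M4) for real nonnegative profiles: `profileModelWeight_re`, `_im`, `_eq_ofReal`, `_re_nonneg`, and the lower
  bounds `le_profileModelWeight_re` (`re μ(n) ≥ (Mv/X) m` where `re p_c ≥ m` at `n/X`, `α ≤ 1`),
  `le_profileModelWeight_re_of_eq_one` (`re μ(n) ≥ Mv/X` where `p_c = 1`).

The decay in `β` (M2), the rescaling / sublattice lemmas (M3) and the `‖c‖_W` corollaries are in the sequel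
`SmoothProfileModelBounds`.

## References

* A. J. Harper, Compositio Math. 152 (2016), §5 (smooth weights on the major arcs; model main terms) [Harper2016].
-/

noncomputable section

open Finset Real Complex MeasureTheory
open scoped FourierTransform

namespace Literature.NumberTheory.Sieve

namespace SmoothArcs

open TwistedWeight Endgame Vinogradov

/-! ### Definitions -/

/-- Model weight of a profile at scale `X`: `μ(n) = (Mv/X) (n/X)^{α−1} p_c(n/X)` for `1 ≤ n ≤ X` (`0` beyond, since
`p_c` vanishes off `(0,1]`). [cite: Harper2016, §5] -/
def profileModelWeight (c : ℤ → ℂ) (Mv X α : ℝ) (n : ℕ) : ℂ :=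
  ((Mv / X * ((n : ℝ) / X) ^ (α - 1) : ℝ) : ℂ) * profileFn c ((n : ℝ) / X)

/-- Model exponential sum `M(β) = Σ_{1 ≤ n ≤ X} μ(n) e(nβ)`. [cite: Harper2016, §5] -/
def profileModelSum (c : ℤ → ℂ) (Mv X α : ℝ) (β : ℝ) : ℂ :=
  ∑ n ∈ Finset.Icc 1 ⌊X⌋₊, profileModelWeight c Mv X α n * (𝐞 ((n : ℝ) * β) : ℂ)

variable {c : ℤ → ℂ}

/-! ### Summability helpers for `S₁ = Σ_ℓ ‖c_ℓ‖(1+|ℓ|)` -/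

/-- `‖c_ℓ‖ ≤ ‖c_ℓ‖(1+|ℓ|)`. [folklore] -/
theorem norm_le_norm_mul_one_add_abs (c : ℤ → ℂ) (ℓ : ℤ) : ‖c ℓ‖ ≤ ‖c ℓ‖ * (1 + |(ℓ : ℝ)|) :=
  le_mul_of_one_le_right (norm_nonneg _) (by linarith [abs_nonneg (ℓ : ℝ)])

/-- `Σ_ℓ ‖c_ℓ‖ < ∞` when `S₁ < ∞`. [folklore] -/
theorem summable_norm_of_mul (hcW : Summable (fun ℓ : ℤ => ‖c ℓ‖ * (1 + |(ℓ : ℝ)|))) :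
    Summable (fun ℓ : ℤ => ‖c ℓ‖) :=
  Summable.of_nonneg_of_le (fun _ => norm_nonneg _) (norm_le_norm_mul_one_add_abs c) hcW

/-- `Σ_ℓ ‖c_ℓ‖ ≤ S₁`. [folklore] -/
theorem tsum_norm_le_tsum_norm_mul (hcW : Summable (fun ℓ : ℤ => ‖c ℓ‖ * (1 + |(ℓ : ℝ)|))) :
    ∑' ℓ : ℤ, ‖c ℓ‖ ≤ ∑' ℓ : ℤ, ‖c ℓ‖ * (1 + |(ℓ : ℝ)|) :=
  Summable.tsum_le_tsum (norm_le_norm_mul_one_add_abs c) (summable_norm_of_mul hcW) hcW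

/-! ### Support of the weights -/

/-- `μ(n) = 0` unless `0 < n/X ≤ 1`. [folklore] -/
theorem profileModelWeight_of_not_mem {X : ℝ} {n : ℕ} (h : (n : ℝ) / X ∉ Set.Ioc (0 : ℝ) 1) (Mv α : ℝ) :
    profileModelWeight c Mv X α n = 0 := by
  rw [profileModelWeight, profileFn_of_not_mem h, mul_zero]

/-- `μ(0) = 0`. [folklore] -/
theorem profileModelWeight_zero (c : ℤ → ℂ) (Mv X α : ℝ) : profileModelWeight c Mv X α 0 = 0 :=
  profileModelWeight_of_not_mem (by simp) Mv α

/-- `μ(n) = 0` for `n > X`. [folklore] -/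
theorem profileModelWeight_eq_zero_of_lt {X : ℝ} {n : ℕ} (h : X < n) (Mv α : ℝ) :
    profileModelWeight c Mv X α n = 0 := by
  refine profileModelWeight_of_not_mem (fun hv => ?_) Mv α
  rcases le_or_gt X 0 with hX | hX
  · exact absurd hv.1 (not_lt.mpr (div_nonpos_of_nonneg_of_nonpos (Nat.cast_nonneg n) hX))
  · exact absurd hv.2 (not_le.mpr ((one_lt_div hX).mpr h))

/-- **Extending the range of summation**: for `⌊X⌋ ≤ N`, `M(β) = Σ_{n=1}^{N} μ(n) e(nβ)` (the added weights
vanish). [folklore] -/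
theorem profileModelSum_eq_sum_Icc {X : ℝ} {N : ℕ} (hN : ⌊X⌋₊ ≤ N) (Mv α β : ℝ) :
    profileModelSum c Mv X α β = ∑ n ∈ Icc 1 N, profileModelWeight c Mv X α n * (𝐞 ((n : ℝ) * β) : ℂ) := by
  unfold profileModelSum
  refine Finset.sum_subset (Finset.Icc_subset_Icc_right hN) fun n hn hn' => ?_
  have hXn : X < n := by
    refine Nat.lt_of_floor_lt (not_le.mp fun h => hn' ?_)
    exact Finset.mem_Icc.mpr ⟨(Finset.mem_Icc.mp hn).1, h⟩
  rw [profileModelWeight_eq_zero_of_lt hXn, zero_mul]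

/-! ### The model weight as a series of single-bump model weights -/

/-- `v^{α−1} W_λ(v) = b_α(v) e(λv)` on `(0,1]`. [folklore] -/
theorem rpow_mul_twistWeight {v : ℝ} (hv : v ∈ Set.Ioc (0 : ℝ) 1) (α lam : ℝ) :
    (((v ^ (α - 1) : ℝ)) : ℂ) * twistWeight lam v = (bump α v : ℂ) * (𝐞 (lam * v) : ℂ) := by
  have hpow : v ^ (α + 1) = v ^ (α - 1) * v ^ 2 := by
    rw [← Real.rpow_natCast v 2, ← Real.rpow_add hv.1]
    congr 1; push_cast; ring
  rw [twistWeight_of_mem hv, bump, hpow]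
  push_cast
  ring

/-- **Termwise expansion**: for `1 ≤ n ≤ X`,
`μ(n) e(nθ) = Σ_ℓ c_ℓ · m_n e(n(θ + ℓ/X))` with `m_n = modelWeight Mv X α n = (Mv/X) b_α(n/X)`. [folklore] -/
theorem profileModelWeight_mul_fourierChar {Mv X α : ℝ} (hX : 0 < X) {n : ℕ} (hn1 : 1 ≤ n) (hnX : (n : ℝ) ≤ X)
    (θ : ℝ) :
    profileModelWeight c Mv X α n * (𝐞 ((n : ℝ) * θ) : ℂ) =
      ∑' ℓ : ℤ, c ℓ * ((modelWeight Mv X α n : ℂ) * (𝐞 ((n : ℝ) * (θ + ℓ / X)) : ℂ)) := by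
  have hv : (n : ℝ) / X ∈ Set.Ioc (0 : ℝ) 1 := ⟨div_pos (by exact_mod_cast hn1) hX, (div_le_one hX).mpr hnX⟩
  rw [profileModelWeight, modelWeight, if_pos ⟨hn1, hnX⟩, profileFn, ← tsum_mul_left, ← tsum_mul_right]
  refine tsum_congr fun ℓ => ?_
  have he : (𝐞 ((n : ℝ) * (θ + ℓ / X)) : ℂ) = (𝐞 ((ℓ : ℝ) * ((n : ℝ) / X)) : ℂ) * 𝐞 ((n : ℝ) * θ) := by
    rw [← Circle.coe_mul, ← AddChar.map_add_eq_mul]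
    congr 2; ring
  have hw : ((Mv / X * ((n : ℝ) / X) ^ (α - 1) : ℝ) : ℂ) * (c ℓ * twistWeight (ℓ : ℝ) ((n : ℝ) / X)) =
      c ℓ * ((Mv / X : ℝ) : ℂ) * ((((((n : ℝ) / X) ^ (α - 1) : ℝ)) : ℂ) * twistWeight (ℓ : ℝ) ((n : ℝ) / X)) := by
    push_cast; ring
  rw [hw, rpow_mul_twistWeight hv, he]
  push_cast
  ring

/-- **The model sum as a series of single-bump model sums**:
`M(θ) = Σ_ℓ c_ℓ · modelSum Mv X α (θ + ℓ/X)` (`X > 0`, `Σ_ℓ ‖c_ℓ‖ < ∞`). [folklore] -/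
theorem profileModelSum_eq_tsum (hc' : Summable (fun ℓ : ℤ => ‖c ℓ‖)) {X : ℝ} (hX : 0 < X) (Mv α θ : ℝ) :
    profileModelSum c Mv X α θ = ∑' ℓ : ℤ, c ℓ * modelSum Mv X α (θ + ℓ / X) := by
  unfold profileModelSum modelSum
  have h1 : ∀ n ∈ Icc 1 ⌊X⌋₊, profileModelWeight c Mv X α n * (𝐞 ((n : ℝ) * θ) : ℂ) =
      ∑' ℓ : ℤ, c ℓ * ((modelWeight Mv X α n : ℂ) * (𝐞 ((n : ℝ) * (θ + ℓ / X)) : ℂ)) := by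
    intro n hn
    obtain ⟨hn1, hnN⟩ := Finset.mem_Icc.mp hn
    exact profileModelWeight_mul_fourierChar hX hn1 (le_trans (by exact_mod_cast hnN) (Nat.floor_le hX.le)) θ
  rw [Finset.sum_congr rfl h1, ← Summable.tsum_finsetSum]
  · refine tsum_congr fun ℓ => ?_
    rw [Finset.mul_sum]
  · intro n _
    refine Summable.of_norm_bounded (hc'.mul_right ‖(modelWeight Mv X α n : ℂ)‖) (fun ℓ => ?_)
    rw [norm_mul, norm_mul, Circle.norm_coe, mul_one]

/-! ### Sup bounds -/

/-- `‖modelSum M x α θ‖ ≤ M` (`⌊x⌋` terms of size `≤ M/x`). [folklore] -/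
theorem norm_modelSum_le {M x α : ℝ} (hM : 0 ≤ M) (hx : 0 < x) (hα : 0 ≤ α) (θ : ℝ) : ‖modelSum M x α θ‖ ≤ M := by
  unfold modelSum
  calc ‖∑ n ∈ Icc 1 ⌊x⌋₊, (modelWeight M x α n : ℂ) * (𝐞 ((n : ℝ) * θ) : ℂ)‖ ≤ ∑ n ∈ Icc 1 ⌊x⌋₊, M / x := by
        refine (norm_sum_le _ _).trans (Finset.sum_le_sum fun n _ => ?_)
        obtain ⟨h0, h1⟩ := modelWeight_bounds hM hx hα n
        rw [norm_mul, Circle.norm_coe, mul_one, Complex.norm_real, Real.norm_eq_abs, abs_of_nonneg h0]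
        exact h1
    _ = (⌊x⌋₊ : ℝ) * (M / x) := by rw [Finset.sum_const, Nat.card_Icc, nsmul_eq_mul]; simp
    _ ≤ x * (M / x) := mul_le_mul_of_nonneg_right (Nat.floor_le hx.le) (by positivity)
    _ = M := by field_simp

/-- **Trivial bound** `‖M(β)‖ ≤ Mv Σ_ℓ ‖c_ℓ‖` (`Mv ≥ 0`, `X > 0`, `α ≥ 0`). [folklore] -/
theorem norm_profileModelSum_le (hc' : Summable (fun ℓ : ℤ => ‖c ℓ‖)) {Mv X α : ℝ} (hMv : 0 ≤ Mv) (hX : 0 < X)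
    (hα : 0 ≤ α) (β : ℝ) : ‖profileModelSum c Mv X α β‖ ≤ Mv * ∑' ℓ : ℤ, ‖c ℓ‖ := by
  rw [profileModelSum_eq_tsum hc' hX]
  refine tsum_of_norm_bounded (hc'.hasSum.mul_left Mv) (fun ℓ => ?_)
  rw [norm_mul, mul_comm]
  exact mul_le_mul_of_nonneg_right (norm_modelSum_le hMv hX hα _) (norm_nonneg _)

/-- `‖μ(n)‖ ≤ (Mv/X) Σ_ℓ ‖c_ℓ‖` (`Mv ≥ 0`, `X > 0`, `α ≥ 0`). [folklore] -/
theorem norm_profileModelWeight_le (hc' : Summable (fun ℓ : ℤ => ‖c ℓ‖)) {Mv X α : ℝ} (hMv : 0 ≤ Mv) (hX : 0 < X)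
    (hα : 0 ≤ α) (n : ℕ) : ‖profileModelWeight c Mv X α n‖ ≤ Mv / X * ∑' ℓ : ℤ, ‖c ℓ‖ := by
  have hS : 0 ≤ Mv / X * ∑' ℓ : ℤ, ‖c ℓ‖ := mul_nonneg (div_nonneg hMv hX.le) (tsum_nonneg fun _ => norm_nonneg _)
  by_cases hn : 1 ≤ n ∧ (n : ℝ) ≤ X
  · have h := profileModelWeight_mul_fourierChar (c := c) (Mv := Mv) (α := α) hX hn.1 hn.2 0
    have hnorm : ‖profileModelWeight c Mv X α n‖ = ‖profileModelWeight c Mv X α n * (𝐞 ((n : ℝ) * 0) : ℂ)‖ := by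
      rw [norm_mul, Circle.norm_coe, mul_one]
    rw [hnorm, h]
    refine tsum_of_norm_bounded (hc'.hasSum.mul_left (Mv / X)) (fun ℓ => ?_)
    obtain ⟨h0, h1⟩ := modelWeight_bounds hMv hX hα n
    rw [norm_mul, norm_mul, Circle.norm_coe, mul_one, Complex.norm_real, Real.norm_eq_abs, abs_of_nonneg h0, mul_comm]
    exact mul_le_mul_of_nonneg_right h1 (norm_nonneg _)
  · rw [profileModelWeight_of_not_mem]
    · rwa [norm_zero]
    · rintro ⟨h0, h1⟩
      refine hn ⟨?_, (div_le_one hX).mp h1⟩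
      have : (0 : ℝ) < n := by
        have := mul_pos h0 hX
        rwa [div_mul_cancel₀ _ hX.ne'] at this
      exact Nat.one_le_iff_ne_zero.mpr (by rintro rfl; simp at this)

/-! ### (M1) Comparison with the Mellin transform -/

/-- `5 + 2π|βX + ℓ| ≤ 12 (1+|βX|)(1+|ℓ|)`. [folklore] -/
private theorem five_add_le (a l : ℝ) : 5 + 2 * π * |a + l| ≤ 12 * (1 + |a|) * (1 + |l|) := by
  have h1 := abs_add_le a l
  have hπ := Real.pi_le_four
  nlinarith [abs_nonneg a, abs_nonneg l, mul_nonneg (abs_nonneg a) (abs_nonneg l), Real.pi_pos]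

/-- **(M1) The model sum reproduces the Mellin main term**: for `X ≥ 1`, `0 ≤ α ≤ 1`, `Mv ≥ 0`,
`‖M(β) − Mv P̂_c(α; βX)‖ ≤ 12 Mv (1+|βX|) S₁ / X`
(termwise `norm_modelSum_sub_main_le` at frequency `βX + ℓ`, and `5 + 2π|βX+ℓ| ≤ 12(1+|βX|)(1+|ℓ|)`).
[cite: Harper2016, §5] -/
theorem norm_profileModelSum_sub_le (hcW : Summable (fun ℓ : ℤ => ‖c ℓ‖ * (1 + |(ℓ : ℝ)|))) {Mv X α : ℝ}
    (hMv : 0 ≤ Mv) (hX : 1 ≤ X) (hα : 0 ≤ α) (hα1 : α ≤ 1) (β : ℝ) :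
    ‖profileModelSum c Mv X α β - (Mv : ℂ) * profileMellin c α (β * X)‖ ≤
      12 * Mv * (1 + |β * X|) * (∑' ℓ : ℤ, ‖c ℓ‖ * (1 + |(ℓ : ℝ)|)) / X := by
  have hc' := summable_norm_of_mul hcW
  have hX0 : 0 < X := by linarith
  have hs : 0 ≤ ((α : ℂ)).re := by simpa using hα
  have hsum1 : Summable (fun ℓ : ℤ => c ℓ * modelSum Mv X α (β + ℓ / X)) := by
    refine Summable.of_norm_bounded (hc'.mul_right Mv) (fun ℓ => ?_)
    rw [norm_mul]
    exact mul_le_mul_of_nonneg_left (norm_modelSum_le hMv hX0 hα _) (norm_nonneg _)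
  have hsum2 : Summable (fun ℓ : ℤ => (Mv : ℂ) * (c ℓ * twistMellin (β * X + ℓ) α)) :=
    (summable_mul_twistMellin hc' hs (β * X)).mul_left _
  rw [profileModelSum_eq_tsum hc' hX0, profileMellin, ← tsum_mul_left, ← Summable.tsum_sub hsum1 hsum2]
  refine (tsum_of_norm_bounded (hcW.hasSum.mul_left (12 * Mv * (1 + |β * X|) / X)) (fun ℓ => ?_)).trans
    (le_of_eq (by ring))
  have e1 : c ℓ * modelSum Mv X α (β + ℓ / X) - (Mv : ℂ) * (c ℓ * twistMellin (β * X + ℓ) α) =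
      c ℓ * (modelSum Mv X α ((β * X + ℓ) / X) - (Mv : ℂ) * twistMellin (β * X + ℓ) α) := by
    rw [show (β * X + ℓ) / X = β + ℓ / X by field_simp]
    ring
  rw [e1, norm_mul]
  have h1 := norm_modelSum_sub_main_le hMv hX hα hα1 (β * X + ℓ)
  have h2 : Mv / X * (5 + 2 * π * |β * X + ℓ|) ≤ 12 * Mv * (1 + |β * X|) / X * (1 + |(ℓ : ℝ)|) := by
    have := mul_le_mul_of_nonneg_left (five_add_le (β * X) ℓ) (div_nonneg hMv hX0.le)
    refine this.trans (le_of_eq ?_)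
    ring
  calc ‖c ℓ‖ * ‖modelSum Mv X α ((β * X + ℓ) / X) - (Mv : ℂ) * twistMellin (β * X + ℓ) α‖
      ≤ ‖c ℓ‖ * (12 * Mv * (1 + |β * X|) / X * (1 + |(ℓ : ℝ)|)) :=
        mul_le_mul_of_nonneg_left (h1.trans h2) (norm_nonneg _)
    _ = 12 * Mv * (1 + |β * X|) / X * (‖c ℓ‖ * (1 + |(ℓ : ℝ)|)) := by ring

/-! ### (M4) Real nonnegative profiles: positivity and lower bounds -/

/-- `re μ(n) = (Mv/X)(n/X)^{α−1} re p_c(n/X)`. [folklore] -/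
theorem profileModelWeight_re (c : ℤ → ℂ) (Mv X α : ℝ) (n : ℕ) :
    (profileModelWeight c Mv X α n).re = Mv / X * ((n : ℝ) / X) ^ (α - 1) * (profileFn c ((n : ℝ) / X)).re := by
  rw [profileModelWeight, Complex.re_ofReal_mul]

/-- `im μ(n) = 0` for a real profile. [folklore] -/
theorem profileModelWeight_im (hreal : ∀ v, (profileFn c v).im = 0) (Mv X α : ℝ) (n : ℕ) :
    (profileModelWeight c Mv X α n).im = 0 := by
  rw [profileModelWeight, Complex.im_ofReal_mul, hreal, mul_zero]

/-- A real profile has real model weights: `μ(n) = ((re μ(n) : ℝ) : ℂ)`. [folklore] -/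
theorem profileModelWeight_eq_ofReal (hreal : ∀ v, (profileFn c v).im = 0) (Mv X α : ℝ) (n : ℕ) :
    profileModelWeight c Mv X α n = (((profileModelWeight c Mv X α n).re : ℝ) : ℂ) :=
  Complex.ext (by simp) (by simp [profileModelWeight_im hreal])

/-- **Nonnegativity**: `re μ(n) ≥ 0` when `re p_c ≥ 0`, `Mv ≥ 0`, `X ≥ 0`. [folklore] -/
theorem profileModelWeight_re_nonneg (hpos : ∀ v, 0 ≤ (profileFn c v).re) {Mv X : ℝ} (hMv : 0 ≤ Mv) (hX : 0 ≤ X)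
    (α : ℝ) (n : ℕ) : 0 ≤ (profileModelWeight c Mv X α n).re := by
  rw [profileModelWeight_re]
  exact mul_nonneg (mul_nonneg (div_nonneg hMv hX) (Real.rpow_nonneg (by positivity) _)) (hpos _)

/-- **Monotone lower bound**: if `re p_c ≥ m ≥ 0` on `[a, b]` then `re μ(n) ≥ (Mv/X) m` for `1 ≤ n ≤ X` with
`n/X ∈ [a, b]` (`α ≤ 1`, so `(n/X)^{α−1} ≥ 1`). [folklore] -/
theorem le_profileModelWeight_re {Mv X α a b m : ℝ} (hMv : 0 ≤ Mv) (hX : 0 < X) (hα1 : α ≤ 1) (hm : 0 ≤ m)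
    (hp : ∀ v ∈ Set.Icc a b, m ≤ (profileFn c v).re) {n : ℕ} (hn1 : 1 ≤ n) (hnX : (n : ℝ) ≤ X)
    (ha : a ≤ (n : ℝ) / X) (hb : (n : ℝ) / X ≤ b) : Mv / X * m ≤ (profileModelWeight c Mv X α n).re := by
  rw [profileModelWeight_re]
  have hv0 : 0 < (n : ℝ) / X := div_pos (by exact_mod_cast hn1) hX
  have hv1 : (n : ℝ) / X ≤ 1 := (div_le_one hX).mpr hnX
  have hpow : 1 ≤ ((n : ℝ) / X) ^ (α - 1) := Real.one_le_rpow_of_pos_of_le_one_of_nonpos hv0 hv1 (by linarith)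
  have hq : 0 ≤ Mv / X := div_nonneg hMv hX.le
  calc Mv / X * m = Mv / X * 1 * m := by ring
    _ ≤ Mv / X * ((n : ℝ) / X) ^ (α - 1) * (profileFn c ((n : ℝ) / X)).re :=
        mul_le_mul (mul_le_mul_of_nonneg_left hpow hq) (hp _ ⟨ha, hb⟩) hm
          (mul_nonneg hq (Real.rpow_nonneg hv0.le _))

/-- **Lower bound on a plateau**: if `p_c = 1` on `[a, b]` then `re μ(n) ≥ Mv/X` for `n/X ∈ [a, b]`
(`α ≤ 1`; such `n/X` lie in `(0,1]` automatically since `p_c` vanishes elsewhere). [folklore] -/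
theorem le_profileModelWeight_re_of_eq_one {Mv X α a b : ℝ} (hMv : 0 ≤ Mv) (hX : 0 < X) (hα1 : α ≤ 1)
    (hp : ∀ v ∈ Set.Icc a b, profileFn c v = 1) {n : ℕ} (ha : a ≤ (n : ℝ) / X) (hb : (n : ℝ) / X ≤ b) :
    Mv / X ≤ (profileModelWeight c Mv X α n).re := by
  have hv : (n : ℝ) / X ∈ Set.Ioc (0 : ℝ) 1 := by
    by_contra h
    have h0 := profileFn_of_not_mem h c
    rw [hp _ ⟨ha, hb⟩] at h0
    exact one_ne_zero h0
  rw [profileModelWeight_re, hp _ ⟨ha, hb⟩, Complex.one_re, mul_one]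
  exact le_mul_of_one_le_right (div_nonneg hMv hX.le)
    (Real.one_le_rpow_of_pos_of_le_one_of_nonpos hv.1 hv.2 (by linarith))

end SmoothArcs

end Literature.NumberTheory.Sieve

end
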